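import Summits.BirchSwinnertonDyer.BirchSwinnertonDyer.Theorems.ResidualThetaTransportAtTwoRlfTwistedSurjEngine
import Literature.NumberTheory.EllipticCurves.ZpExtensionGaloisTwistLocal
import HarnessLib

/-!
# (TCAS♯) from the LEVEL-`K` twisted Cassels statement and the twisted local `Γ`-descent at `S₀` — the reduction of the
# twisted Cassels♯ input of road T (item 23110) to Greenberg's Prop. 4.13 for `A_s = E[p^J](χ_u)` over `K`

Route `ResidualThetaTransportAtTwo` (RTT, crux r201 `ResidualLambdaFormulaNegDiscAtTwo`, stmt-BirchSwinnertonDyer-23110) /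
`ThetaPartnerAtTwo` (TP2). Seat `prover-bsd-wall-tp2-p2x` g12 (`--supports stmt-BirchSwinnertonDyer-23110`). THEOREMS ONLY (no
definition, no named fact, no `sorry`); route-independent imports. Sequel of `…RlfTwistedSurjEngine` (p652574)
and `…RlfOfTwistedDescent` (p654602), whose hypothesis (TCAS♯) «every family of `p`-power-torsion twisted eigenvectors
`z_v ∈ 𝒫_v = H¹(Gal(K̄_v/(K_∞)_η), E(K̄_v))` (`u^{N_v}·conj_{g_v} z_v = z_v`, `v ∈ S₀`) is `(loc_v c)` for a `ψ_u`-invariant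
`c ∈ Sel♯_{S₀}(E/K_∞)`» is here DERIVED from two statements about Greenberg's finite twisted modules
`A_J = E[p^J](χ_u)` (tree: `WeierstrassCurve.twistedTorsionGaloisModule`, cell t42) — the currency in which Poitou–Tate over `K` is
available:

* (TCAS-K) «twisted Cassels over `K`, level `J`»: every family `(t_v)_v` of local classes `t_v ∈ H¹(Γ_{K_v}, A_J)` is, at the places
  `v ∈ S₀`, the localisation `res_v x` of a global class `x ∈ H¹(Γ_K, A_J)` whose image `twistedTorsionToH1 x ∈ H¹(K_∞, E[p^∞])`
  lies in `Sel♯_{S₀}` (i.e. `x` unramified outside `S₀ ∪ {p, ∞}` and signed-Kummer above `p`) — Greenberg's surjectivity of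
  `γ' : H¹(F_Σ/F, M) → 𝒫^{Σ'}(M, F)` for `M = A_s` with `L_v = 0` on `S₀` (LNM 1716 Prop. 4.13 + Remark, pp. 122–123; Poitou–Tate);
* (LOC-S₀) «twisted local `Γ`-descent at `v ∈ S₀`»: every `p`-power-torsion `z ∈ 𝒫_v` with `u^{N_v}·conj_{g_v} z = z` is
  `twistedTorsionToLocalH1 t` for some `t ∈ H¹(Γ_{K_v}, A_J)`, for every `J` beyond some `J₀` (`cd_p ℤ_p = 1`: the image of
  `H¹(Γ_{K_v}, A_J) → H¹((K_∞)_η, A_J)` is the twisted-invariant part; Greenberg p. 108 / p. 124);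

via the commutative square `localResOver_v ∘ twistedTorsionToH1 = twistedTorsionToLocalH1 ∘ res_v` (tree
`WeierstrassCurve.localResOver_twistedTorsionToH1`) and the `ψ_u`-invariance of `twistedTorsionToH1 x` (tree
`WeierstrassCurve.zsmul_conjH1_twistedTorsionToH1`). Any number field `K`, prime `p`, `ℤ_p`-extension `κ` with topological
generator `γ`, sign `ε`, finite `S₀`, `u ≡ 1 (mod p)`, local data `N`, `g`.

HONEST FRAMING: (TCAS-K) and (LOC-S₀) are displayed hypotheses — the research inputs (R5)/(R4) of memo RLF-TWIST-ROAD-g12; closes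
nothing; BSD is not proved by any of this.
References: [GreenbergLNM1716] §4 pp. 107–108, Prop. 4.13 and Remark pp. 122–123, p. 124; [SerreGaloisCohomology1997] I §2.6 (b).
-/

set_option autoImplicit false
set_option linter.dupNamespace false

noncomputable section

open scoped Classical NumberField

open NumberField IsDedekindDomain

namespace Summit.BirchSwinnertonDyer.BirchSwinnertonDyer.Theorems.SignedEC.TwistedSurj

open Literature.NumberTheory.EllipticCurves Literature.NumberTheory.GaloisRepresentations
  WeierstrassCurve ZpExtension Literature.NumberTheory.EllipticCurves.Kobayashi2003
  Literature.NumberTheory.EllipticCurves.GreenbergVatsal2000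

universe u

variable {K : Type u} [Field K] [NumberField K] (W : WeierstrassCurve K) (p : ℕ) [Fact p.Prime]

/-- **(TCAS♯) ⟸ (TCAS-K) + (LOC-S₀).** `K` a number field, `p` prime, `κ` a `ℤ_p`-extension with topological generator `γ`,
`ε` a sign, `S₀` finite, `u ≡ 1 (mod p)`, local data `N`, `g`. If, for every level `J`, every family of local classes
`t_v ∈ H¹(Γ_{K_v}, E[p^J](χ_u))` is `(res_v x)_{v ∈ S₀}` for some `x ∈ H¹(Γ_K, E[p^J](χ_u))` with `twistedTorsionToH1 x ∈ Sel♯_{S₀}`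
(TCAS-K), and if at each `v ∈ S₀` every `p`-power-torsion twisted eigenvector of `𝒫_v` is eventually (in `J`) in the image of
`twistedTorsionToLocalH1` (LOC-S₀), then (TCAS♯): every family of `p`-power-torsion twisted eigenvectors `(z_v)_{v ∈ S₀}` is
`(loc_v c)` for a `c ∈ Sel♯_{S₀}(E/K_∞)` with `u·conj_γ c = c` — the hypothesis `htwCas` of
`sharp_localRes_surjective_of_twistedCassels_of_twistedCoinv` / `rlf2_of_twistedDescent`.
[cite: GreenbergLNM1716, §4 Prop. 4.13 Remark (p. 123), pp. 107–108, 124] -/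
theorem twistedCassels_sharp_of_level (κ : ZpExtension K p) (ε : ℤˣ) {γ : Field.absoluteGaloisGroup K}
    (hγ : κ.IsTopGenerator γ) (S₀ : Finset (HeightOneSpectrum (𝓞 K))) {u : ℤ} (hu : (p : ℤ) ∣ u - 1)
    (N : HeightOneSpectrum (𝓞 K) → ℕ)
    (g : ∀ v : HeightOneSpectrum (𝓞 K), Field.absoluteGaloisGroup (v.adicCompletion K))
    (hlev : ∀ (J : ℕ) (t : ∀ v : HeightOneSpectrum (𝓞 K),
        galoisCohomology ((W.twistedTorsionGaloisModule p κ J u hu).restrictField (v.adicCompletion K)) 1),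
      ∃ x : galoisCohomology (W.twistedTorsionGaloisModule p κ J u hu) 1,
        W.twistedTorsionToH1 p κ J u hu x ∈
            unramifiedOutside κ.kerSubgroup ↥(W.geomPrimaryTorsion p) p (↑S₀ : Set (HeightOneSpectrum (𝓞 K))) ⊓
              ⨅ (v : HeightOneSpectrum (𝓞 K)) (_ : ((p : ℕ) : 𝓞 K) ∈ v.asIdeal) (σ : Field.absoluteGaloisGroup K),
                (localKummerOverOfEmb W p κ.kerSubgroup (closureEmb (K := K) (v.adicCompletion K))
                  (⨆ n : ℕ, signedLocalPoints κ (v.adicCompletion K) W ε n)).comap (W.conjH1 p κ.kerSubgroup σ) ∧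
          ∀ v ∈ S₀, galoisCohomology.res (W.twistedTorsionGaloisModule p κ J u hu) (v.adicCompletion K) 1 x = t v)
    (hloc : ∀ v ∈ S₀, ∀ z : discreteH1 (localSubgroup κ.kerSubgroup (v.adicCompletion K)) (localPoints W (v.adicCompletion K)),
      (∃ k : ℕ, p ^ k • z = 0) →
      u ^ N v • Literature.NumberTheory.EllipticCurves.conjH1 (localSubgroup κ.kerSubgroup (v.adicCompletion K))
          (localPoints W (v.adicCompletion K)) (g v) z = z →
      ∃ J₀ : ℕ, ∀ J : ℕ, J₀ ≤ J →
        ∃ t : galoisCohomology ((W.twistedTorsionGaloisModule p κ J u hu).restrictField (v.adicCompletion K)) 1,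
          W.twistedTorsionToLocalH1 p κ J u hu (v.adicCompletion K) t = z)
    (z : ∀ v : HeightOneSpectrum (𝓞 K),
      discreteH1 (localSubgroup κ.kerSubgroup (v.adicCompletion K)) (localPoints W (v.adicCompletion K)))
    (hztor : ∀ v ∈ S₀, ∃ k : ℕ, p ^ k • z v = 0)
    (hzeig : ∀ v ∈ S₀, u ^ N v • Literature.NumberTheory.EllipticCurves.conjH1 (localSubgroup κ.kerSubgroup (v.adicCompletion K))
        (localPoints W (v.adicCompletion K)) (g v) (z v) = z v) :
    ∃ c ∈ unramifiedOutside κ.kerSubgroup ↥(W.geomPrimaryTorsion p) p (↑S₀ : Set (HeightOneSpectrum (𝓞 K))) ⊓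
        ⨅ (v : HeightOneSpectrum (𝓞 K)) (_ : ((p : ℕ) : 𝓞 K) ∈ v.asIdeal) (σ : Field.absoluteGaloisGroup K),
          (localKummerOverOfEmb W p κ.kerSubgroup (closureEmb (K := K) (v.adicCompletion K))
            (⨆ n : ℕ, signedLocalPoints κ (v.adicCompletion K) W ε n)).comap (W.conjH1 p κ.kerSubgroup σ),
      u • W.conjH1 p κ.kerSubgroup γ c = c ∧
        ∀ v ∈ S₀, W.localResOver p κ.kerSubgroup (v.adicCompletion K) c = z v := by
  -- the eventual levels at the places of `S₀` (junk `0` elsewhere)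
  have hJ : ∀ v : HeightOneSpectrum (𝓞 K), ∃ J₀ : ℕ, v ∈ S₀ → ∀ J : ℕ, J₀ ≤ J →
      ∃ t : galoisCohomology ((W.twistedTorsionGaloisModule p κ J u hu).restrictField (v.adicCompletion K)) 1,
        W.twistedTorsionToLocalH1 p κ J u hu (v.adicCompletion K) t = z v := by
    intro v
    by_cases hv : v ∈ S₀
    · obtain ⟨J₀, hJ₀⟩ := hloc v hv (z v) (hztor v hv) (hzeig v hv)
      exact ⟨J₀, fun _ ↦ hJ₀⟩
    · exact ⟨0, fun h ↦ absurd h hv⟩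
  choose J₀ hJ₀ using hJ
  -- a common level `J ≥ J₀ v` for all `v ∈ S₀`
  set J : ℕ := S₀.sup J₀ with hJdef
  have hJle : ∀ v ∈ S₀, J₀ v ≤ J := fun v hv ↦ Finset.le_sup (f := J₀) hv
  -- the local classes at level `J`
  have ht : ∀ v : HeightOneSpectrum (𝓞 K), ∃ t :
      galoisCohomology ((W.twistedTorsionGaloisModule p κ J u hu).restrictField (v.adicCompletion K)) 1,
      v ∈ S₀ → W.twistedTorsionToLocalH1 p κ J u hu (v.adicCompletion K) t = z v := by
    intro v
    by_cases hv : v ∈ S₀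
    · obtain ⟨t, ht⟩ := hJ₀ v hv J (hJle v hv)
      exact ⟨t, fun _ ↦ ht⟩
    · exact ⟨0, fun h ↦ absurd h hv⟩
  choose t ht using ht
  -- (TCAS-K) at level `J`
  obtain ⟨x, hxS, hxt⟩ := hlev J t
  refine ⟨W.twistedTorsionToH1 p κ J u hu x, hxS, W.zsmul_conjH1_twistedTorsionToH1 p κ J u hu hγ x, fun v hv ↦ ?_⟩
  rw [W.localResOver_twistedTorsionToH1 p κ J u hu (v.adicCompletion K) x, hxt v hv]
  exact ht v hv

end Summit.BirchSwinnertonDyer.BirchSwinnertonDyer.Theorems.SignedEC.TwistedSurj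

end
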